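import Mathlib
import Summits.Ventures.PercRepro2.Defs
import Summits.Ventures.PercRepro2.Graph
import Summits.Ventures.PercRepro2.Events
import Summits.Ventures.PercRepro2.MM0Sector
import Summits.Ventures.PercRepro2.MM0Pinned
import Summits.Ventures.PercRepro2.LeafDelete

/-!
# Row 2′MM0: deleting an unmarked leaf leaves (MM0⁻) and `PinnedMM0` unchanged
(blind cell PercRepro2, night-1 g4; `proofs/NIGHT1-G4.md` §3)

The leaf step of the MARKED-SKELETON reduction behind «(MM0⁻) on every forest»: every mass of
`mm0minusForm`, every three-copy kernel value and every pattern coefficient of `MM0Pinned` is the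
probability / count of events that are Boolean combinations of connection events between the six
marks `s t b u w v`; by `LeafDelete.connEvent_update_loop` (p1) a connection between two vertices
other than a leaf `ℓ` is unchanged when the leaf edge `f = s(ℓ, x)` is re-pointed to the loop
`s(ℓ, ℓ)` (same edge set, same weights). Hence, for a leaf `ℓ` carrying no mark:

* `gate_update_loop`, `Zev_update_loop`, `hits_update_loop`, `bridge_update_loop`;
* `mm0minusForm_update_loop`, `sector0Form_update_loop`, `sector1Form_update_loop`
  (the (MM0⁻) form and its sector split are unchanged, for every weight vector);
* `tripleKernel_update_loop`, `patternCoeff3_update_loop`, **`pinnedMM0_update_loop_iff`**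
  (the weight-free statement `PinnedMM0` is unchanged).

Together with `MM0Pinned.mm0minus_of_pinned` this is the Lean half of the leaf rule of the reduction;
the series rule (an unmarked vertex of degree two, weights multiply) is paper for now.
-/

namespace Summit.Ventures.PercRepro2
namespace MM0Prune

open MM0Sector MM0Pinned LeafDelete

variable {V : Type*} {E : Type*} [Fintype E] [DecidableEq E] [Fintype V] [DecidableEq V]
  {R : Type*} [CommRing R] [LinearOrder R] [IsStrictOrderedRing R]

section Events

variable {ends : E → Sym2 V} {f : E} {ℓ x : V}

omit [Fintype E] [Fintype V] [DecidableEq V] in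
/-- `bridge` is unchanged when an unmarked leaf edge is re-pointed to a loop. -/
lemma bridge_update_loop (hf : ends f = s(ℓ, x)) (hleaf : ∀ e, ℓ ∈ ends e → e = f) (hℓx : ℓ ≠ x)
    {s t u w : V} (hs : s ≠ ℓ) (ht : t ≠ ℓ) (hu : u ≠ ℓ) (hw : w ≠ ℓ) :
    bridge (Function.update ends f s(ℓ, ℓ)) s t u w = bridge ends s t u w := by
  simp only [bridge, connEvent_update_loop hf hleaf hℓx hs hu, connEvent_update_loop hf hleaf hℓx ht hw,
    connEvent_update_loop hf hleaf hℓx hs hw, connEvent_update_loop hf hleaf hℓx ht hu]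

omit [Fintype E] [Fintype V] [DecidableEq V] in
/-- `gate` is unchanged when an unmarked leaf edge is re-pointed to a loop. -/
lemma gate_update_loop (hf : ends f = s(ℓ, x)) (hleaf : ∀ e, ℓ ∈ ends e → e = f) (hℓx : ℓ ≠ x)
    {s t u w : V} (hs : s ≠ ℓ) (ht : t ≠ ℓ) (hu : u ≠ ℓ) (hw : w ≠ ℓ) :
    gate (Function.update ends f s(ℓ, ℓ)) s t u w = gate ends s t u w := by
  simp only [gate, bridge_update_loop hf hleaf hℓx hs ht hu hw, connEvent_update_loop hf hleaf hℓx hs ht]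

omit [Fintype E] [Fintype V] [DecidableEq V] in
/-- `Zev` is unchanged when an unmarked leaf edge is re-pointed to a loop. -/
lemma Zev_update_loop (hf : ends f = s(ℓ, x)) (hleaf : ∀ e, ℓ ∈ ends e → e = f) (hℓx : ℓ ≠ x)
    {t u w v : V} (ht : t ≠ ℓ) (hu : u ≠ ℓ) (hw : w ≠ ℓ) (hv : v ≠ ℓ) :
    Zev (Function.update ends f s(ℓ, ℓ)) t u w v = Zev ends t u w v := by
  simp only [Zev, connEvent_update_loop hf hleaf hℓx ht hv, connEvent_update_loop hf hleaf hℓx hv hu,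
    connEvent_update_loop hf hleaf hℓx ht hw, connEvent_update_loop hf hleaf hℓx hv hw,
    connEvent_update_loop hf hleaf hℓx ht hu]

omit [Fintype E] [Fintype V] [DecidableEq V] in
/-- `hits` is unchanged when an unmarked leaf edge is re-pointed to a loop. -/
lemma hits_update_loop (hf : ends f = s(ℓ, x)) (hleaf : ∀ e, ℓ ∈ ends e → e = f) (hℓx : ℓ ≠ x)
    {t u w : V} (ht : t ≠ ℓ) (hu : u ≠ ℓ) (hw : w ≠ ℓ) :
    hits (Function.update ends f s(ℓ, ℓ)) t u w = hits ends t u w := by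
  simp only [hits, connEvent_update_loop hf hleaf hℓx ht hu, connEvent_update_loop hf hleaf hℓx ht hw]

end Events

section Forms

variable (p : E → R) {ends : E → Sym2 V} {f : E} {ℓ x : V}
  (hf : ends f = s(ℓ, x)) (hleaf : ∀ e, ℓ ∈ ends e → e = f) (hℓx : ℓ ≠ x)
  {s t b u w v : V} (hs : s ≠ ℓ) (ht : t ≠ ℓ) (hb : b ≠ ℓ) (hu : u ≠ ℓ) (hw : w ≠ ℓ) (hv : v ≠ ℓ)

include hf hleaf hℓx hs ht hb hu hw hv in
omit [Fintype V] [DecidableEq V] [LinearOrder R] [IsStrictOrderedRing R] in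
/-- **Leaf deletion for (MM0⁻)**: the cubic form of row 2′MM0 is unchanged when the edge of a leaf
`ℓ` carrying none of the six marks is re-pointed to a loop. -/
theorem mm0minusForm_update_loop :
    mm0minusForm p (Function.update ends f s(ℓ, ℓ)) s t b u w v = mm0minusForm p ends s t b u w v := by
  simp only [mm0minusForm, gate_update_loop hf hleaf hℓx hs ht hu hw, Zev_update_loop hf hleaf hℓx ht hu hw hv,
    connEvent_update_loop hf hleaf hℓx hs ht, connEvent_update_loop hf hleaf hℓx hs hb,
    connEvent_update_loop hf hleaf hℓx ht hv]

include hf hleaf hℓx hs ht hb hu hw hv in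
omit [Fintype V] [LinearOrder R] [IsStrictOrderedRing R] in
/-- The sector-0 form is unchanged under leaf deletion. -/
theorem sector0Form_update_loop :
    sector0Form p (Function.update ends f s(ℓ, ℓ)) s t b u w v = sector0Form p ends s t b u w v := by
  have hav : avoidAll (Function.update ends f s(ℓ, ℓ)) t {s, u, w} = avoidAll ends t {s, u, w} := by
    rw [avoidAll_tsuw, avoidAll_tsuw, hits_update_loop hf hleaf hℓx ht hu hw,
      connEvent_update_loop hf hleaf hℓx hs ht]
  simp only [sector0Form, hav, connEvent_update_loop hf hleaf hℓx hs ht,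
    connEvent_update_loop hf hleaf hℓx hs hb, connEvent_update_loop hf hleaf hℓx ht hv]

include hf hleaf hℓx hs ht hb hu hw hv in
omit [Fintype V] [DecidableEq V] [LinearOrder R] [IsStrictOrderedRing R] in
/-- The sector-1 form is unchanged under leaf deletion. -/
theorem sector1Form_update_loop :
    sector1Form p (Function.update ends f s(ℓ, ℓ)) s t b u w v = sector1Form p ends s t b u w v := by
  simp only [sector1Form, gate_update_loop hf hleaf hℓx hs ht hu hw, Zev_update_loop hf hleaf hℓx ht hu hw hv,
    hits_update_loop hf hleaf hℓx ht hu hw, connEvent_update_loop hf hleaf hℓx hs ht,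
    connEvent_update_loop hf hleaf hℓx hs hb, connEvent_update_loop hf hleaf hℓx ht hv]

end Forms

section Pinned

variable {ends : E → Sym2 V} {f : E} {ℓ x : V}
  (hf : ends f = s(ℓ, x)) (hleaf : ∀ e, ℓ ∈ ends e → e = f) (hℓx : ℓ ≠ x)
  {s t b u w v : V} (hs : s ≠ ℓ) (ht : t ≠ ℓ) (hb : b ≠ ℓ) (hu : u ≠ ℓ) (hw : w ≠ ℓ) (hv : v ≠ ℓ)

include hf hleaf hℓx hs ht hb hu hw hv in
omit [Fintype E] [Fintype V] [DecidableEq V] [LinearOrder R] [IsStrictOrderedRing R] in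
/-- The three-copy kernel is unchanged under leaf deletion. -/
theorem tripleKernel_update_loop (y z xc : Config E) :
    tripleKernel (R := R) (Function.update ends f s(ℓ, ℓ)) s t b u w v y z xc =
      tripleKernel (R := R) ends s t b u w v y z xc := by
  unfold tripleKernel
  rw [gate_update_loop hf hleaf hℓx hs ht hu hw, Zev_update_loop hf hleaf hℓx ht hu hw hv,
    connEvent_update_loop hf hleaf hℓx hs ht, connEvent_update_loop hf hleaf hℓx hs hb,
    connEvent_update_loop hf hleaf hℓx ht hv]

include hf hleaf hℓx hs ht hb hu hw hv in
omit [Fintype V] [DecidableEq V] [LinearOrder R] [IsStrictOrderedRing R] in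
/-- Every pattern coefficient is unchanged under leaf deletion. -/
theorem patternCoeff3_update_loop (pat : Config E × Config E × Config E) :
    patternCoeff3 (R := R) (Function.update ends f s(ℓ, ℓ)) s t b u w v pat =
      patternCoeff3 (R := R) ends s t b u w v pat := by
  simp only [patternCoeff3, tripleKernel_update_loop hf hleaf hℓx hs ht hb hu hw hv]

include hf hleaf hℓx hs ht hb hu hw hv in
omit [Fintype V] [DecidableEq V] [IsStrictOrderedRing R] in
/-- **Leaf deletion for `PinnedMM0`**: the weight-free statement of row 2′MM0 holds on a graph iff it
holds after re-pointing the edge of an unmarked leaf to a loop. -/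
theorem pinnedMM0_update_loop_iff :
    PinnedMM0 (R := R) (Function.update ends f s(ℓ, ℓ)) s t b u w v ↔ PinnedMM0 (R := R) ends s t b u w v := by
  simp only [PinnedMM0, patternCoeff3_update_loop hf hleaf hℓx hs ht hb hu hw hv]

end Pinned

end MM0Prune
end Summit.Ventures.PercRepro2
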